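/-
Copyright: statement-level skeleton of a published paper (lit-balaban cell, Phase-2 proof seat p32 gen 44). No claims beyond
what the kernel checks below.
-/
import Literature.MathematicalPhysics.QuantumFieldTheory.Balaban1983to89.B3GraphIso

/-!
# B3 — T. Bałaban, *(Higgs)₂,₃ quantum fields in a finite volume. III. Renormalization*, CMP **88** (1983) 411–445
[Balaban1983Higgs3] — p. 416 [PDF 6] (1.21): THE PIECES `V_0, …, V_m` OF A CONNECTED TWO-LEG GRAPH AS GRAPHS OF THE MODEL —
the `k`-th piece of the chain decomposition of `B3OnePIChainDecomposition` / `B3OnePIChainPieces` (the vertices of level `k`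
with the lines of the graph joining them) re-indexed as a `B3Cor23Concrete.Graph` and, with the two cut separating lines as
its ports, as a two-leg insertion `B3OnePIChainGlue.TwoLegGraph`; each piece is CONNECTED and PROPER BETWEEN ITS PORTS

statement-level skeleton of published theorems with citation tags; proofs where landed; nothing here is a claim about
the Yang–Mills mass gap

PDF held: `paper:balaban1983-higgs-2-3-quantum-fields-finite-volume` (journal page = PDF page + 410); p. 415 L28–31 and p. 416
L13–18 of the OCR text layer re-read this session (`lit read … --pages 5-6`).

CITATION HEADER (lean-in-tree rule).  lit-balaban TYPED SKELETON (HOME `run/shared/lean/pub/lit-balaban/`), PHASE 2, seat p32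
gen 44 (unit `lit-balaban-p32`; TAKING line HOME/STATUS.md 2026-08-23T13:19:54Z, free-target protocol G.5-34(d); FILE 2a of
the item «glue ∘ decompose ≅ identity», split for size from the announced `B3OnePIChainUnglue`), row **B3.Eq1.19-1.22** of
`HOME/lit-balaban-r15/ROWS-B3.md` (fold owner r15, referee ref-4; head `proved` under the lead g12 HEAD WORD Q25, reading (P);
an OPTIONAL located member of its (1.21) cell, zero head weight).  CONSUMES BY NAME: p18's `B3Cor23Concrete.Graph` / `Leg`
(p. 415), p37's `B3OnePIGraphs.Adj` / `AdjOff` / `IsConnected` (p358806), `B3OnePIChainGlue.TwoLegGraph` (p363250),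
`B3GraphGlueLegs.fibreCast` (p362350); p32's `B3OnePIChainDecomposition.Sep` / `IsNear` / `level` / `numSep` /
`exists_isNear_level_eq` / `IsNear.eq_of_level_eq` / `level_far` (p361829), `B3OnePIChainPieces.pieces_connected` /
`proper_zero` / `proper_succ` / `proper_last` / `proper_none` / `not_sep_of_level_eq` / `numSep_eq_zero_iff` (p362812),
`B3GraphIso.legOf` / `leg_ext` (p366156).  Nothing re-declared.

THE PRINTED TEXT (verbatim).  p. 416: *"G^ε = Σ_{n=0}^∞ C₀^ε[(−δm² + Σ^ε + ∂^{ε*}Σ₁^ε + Σ₁^{ε*}∂^ε + ∂^{ε*}Σ₂^ε∂^ε)C₀^ε]ⁿ, (1.21)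
where C₀^ε = (−Δ₀^ε + m²)^{−1} and Σ^ε, Σ₁^ε, Σ₂^ε are given by amputated, one-particle-irreducible graphs of the expansion of
G^ε."*  p. 415: *"Now a graph for us is a collection of internal lines, external legs, and vertices connected in the usual
sense. There is at least one internal line, and every internal line has a vertex at each endpoint. The construction of graphs
is otherwise arbitrary."*  Print states the chain structure of (1.21) without proof; gen 42 derived it at vertex level
(pieces = level sets, separating lines between consecutive pieces); this file turns the pieces into graphs of the model in
their own right.

KIND «(ours)» (G.5-54): the constructions are OUR plumbing on p18's model — print provenance is claimed only for the sentences
quoted above; each declaration's cite tag locates the printed notion it serves.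
WHAT IS TYPED / PROVED (definitions with bodies + theorems; no `Prop` fact, no `sorry`; standard axioms). For a two-leg
insertion `T` (roots = the vertices of its ports; local notations `Lv T v` = `level T.G T.legIn.1 T.legOut.1 v`, `Ns T` =
`numSep T.G T.legIn.1 T.legOut.1` = `m`):
* `§1` THE PORTS OF THE PIECES: `nearAt T k` / `farAt T k` (the near / far leg of the `k`-th separating line — well defined by
  gen 42's `IsNear.eq_of_level_eq`; `nearAt_spec`, `eq_nearAt`, `other_nearAt`, `lvl_farAt`, `sep_farAt`), `portIn T k` (=
  `T.legIn` for `k = 0`, else `farAt T (k-1)`), `portOut T k` (= `T.legOut` for `k = m`, else `nearAt T k`); `lvl_portIn` /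
  `lvl_portOut` (both at level `k`), `other_portIn_succ` / `other_portOut_of_lt` (consecutive ports are the two legs of one
  separating line), `other_portIn_zero` / `other_portOut_nsep` (external), `lvl_of_other_portIn` / `_portOut` (their lines leave
  the level), **`portIn_ne_portOut`**.
* `§2` THE HYPOTHESES **`SepScalar T`** ((a) the separating lines are φ′-lines), **`SpansLine T k`** ((b) the level set `V_k`
  spans an internal line), **`Unglueable T`** (connected ∧ (a) ∧ (b) for all `k ≤ m`); THE PIECES: `pieceVerts`, `pieceCard`,
  `pieceEmb T k : Fin (pieceCard T k) ↪o Fin T.G.nV` (increasing enumeration of `V_k`; `lvl_pieceEmb`, `exists_pieceEmb_eq`),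
  `pieceIdx`, `pieceKind`, `pieceLeg` / `liftLeg` / `pieceLegInv` (legs of the piece ↔ legs of `T` at level `k`;
  `pieceLeg_liftLeg`, `liftLeg_pieceLeg`, `pieceLegInv_eq_some_iff`), **`pieceOther`** (the lines of `T` inside `V_k`;
  `pieceOther_eq_some_iff`, `pieceOther_eq_none_iff`, `pieceOther_liftLeg`), **`pieceGraph T k h : Graph n̄`** (exists_line =
  hypothesis (b)), `adj_pieceGraph_iff`, `reflTransGen_pieceIdx`, **`isConnected_pieceGraph`** (gen 42's `pieces_connected`
  inside the piece), `adjOff_pieceGraph_of`, **`numSep_pieceGraph_ports`** (gen 42's `proper_*` inside the piece: no line of the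
  piece separates its ports), and **`piece T hU k hk : TwoLegGraph n̄`** (in-port / out-port lifted; external in the piece,
  distinct, scalar by (a)) with **`isConnected_piece`**, **`numSep_piece`** (`= 0`), `piece_nV`.
HONEST SCOPE. The hypotheses are genuine: on p18's carrier a VECTOR line may separate two scalar external legs (e.g. two
vertices (1.14), one φ′-leg each, joined by an A′-line), and a piece may span no line (a bare vertex (1.7) met along the channel
— print's separate letter `−δm²` of (1.21), which is not a graph, p. 415); such `T` are not chains of `TwoLegGraph`s glued along
φ′-lines and are excluded by (a)/(b), not treated. "Proper between its ports" is `numSep = 0` for the two ports (the channel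
notion); a piece may keep further external legs of `T` and parts hanging off the channel, so p37's stronger `IsProper` (all
pairs of external legs) is not claimed for it. The ungluing isomorphism `T ≅ chain (pieces)` is the sibling
`B3OnePIChainUnglue`; no amplitude; nothing analytic.
-/

namespace Literature.MathematicalPhysics.QuantumFieldTheory.Balaban1983to89.B3OnePIChainPieceGraphs

open Relation Finset B3Prop1 B3Cor23Concrete B3OnePIGraphs B3OnePIChainDecomposition B3OnePIChainPieces B3GraphGlueLegs
  B3GraphGlue B3OnePIChainGlue B3GraphIso

variable {nbar : ℕ}

/-- `Lv T v`: the LEVEL of the vertex `v` of the two-leg insertion `T` between its ports (local notation for p32's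
`B3OnePIChainDecomposition.level T.G T.legIn.1 T.legOut.1 v`). -/
local notation:max "Lv " T:max =>
  level (TwoLegGraph.G T) (Sigma.fst (TwoLegGraph.legIn T)) (Sigma.fst (TwoLegGraph.legOut T))

/-- `Ns T`: the NUMBER OF SEPARATING LINES `m` between the ports of `T` (local notation for
`B3OnePIChainDecomposition.numSep T.G T.legIn.1 T.legOut.1`). -/
local notation:max "Ns " T:max =>
  numSep (TwoLegGraph.G T) (Sigma.fst (TwoLegGraph.legIn T)) (Sigma.fst (TwoLegGraph.legOut T))

/-! ## §1 The ports of the pieces of a two-leg insertion -/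

section Ports

variable (T : TwoLegGraph nbar)

/-- The NEAR leg of the `k`-th separating line (the one whose vertex has level `k`; junk value `T.legIn` if there is none).
[cite: Balaban1983Higgs3, (1.21) p.416] -/
noncomputable def nearAt (k : ℕ) : Leg T.G.kind :=
  open Classical in
  if h : ∃ c, IsNear T.G T.legIn.1 T.legOut.1 c ∧ Lv T c.1 = k then h.choose else T.legIn

/-- The FAR leg of the `k`-th separating line (the other endpoint of the line through `nearAt T k`; junk value `T.legOut`).
[cite: Balaban1983Higgs3, (1.21) p.416] -/
noncomputable def farAt (k : ℕ) : Leg T.G.kind :=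
  (T.G.other (nearAt T k)).elim T.legOut id

/-- The IN-PORT of the `k`-th piece: the in-leg of `T` for `k = 0`, else the far leg of the `(k-1)`-th separating line.
[cite: Balaban1983Higgs3, (1.21) p.416] -/
noncomputable def portIn (k : ℕ) : Leg T.G.kind :=
  if k = 0 then T.legIn else farAt T (k - 1)

/-- The OUT-PORT of the `k`-th piece: the out-leg of `T` for `k = m`, else the near leg of the `k`-th separating line.
[cite: Balaban1983Higgs3, (1.21) p.416] -/
noncomputable def portOut (k : ℕ) : Leg T.G.kind :=
  if k = Ns T then T.legOut else nearAt T k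

variable {T}
variable (hT : IsConnected T.G)
include hT

/-- kernel: the `k`-th near leg is a near leg at level `k` (`k < m`). [cite: Balaban1983Higgs3, (1.21) p.416] -/
theorem nearAt_spec {k : ℕ} (hk : k < Ns T) :
    IsNear T.G T.legIn.1 T.legOut.1 (nearAt T k) ∧ Lv T (nearAt T k).1 = k := by
  classical
  have h : ∃ c, IsNear T.G T.legIn.1 T.legOut.1 c ∧ Lv T c.1 = k := exists_isNear_level_eq hT hk
  rw [nearAt, dif_pos h]
  exact h.choose_spec

/-- kernel: a near leg at level `k` IS the `k`-th near leg («the k-th separating line»).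
[cite: Balaban1983Higgs3, (1.21) p.416] -/
theorem eq_nearAt {k : ℕ} {c : Leg T.G.kind} (hc : IsNear T.G T.legIn.1 T.legOut.1 c) (hck : Lv T c.1 = k) :
    c = nearAt T k := by
  have hlt : Lv T c.1 < Ns T := hc.level_lt
  rw [hck] at hlt
  exact hc.eq_of_level_eq hT (nearAt_spec hT hlt).1 (hck.trans (nearAt_spec hT hlt).2.symm)

/-- kernel: the `k`-th separating line joins its near leg to its far leg. [cite: Balaban1983Higgs3, (1.21) p.416] -/
theorem other_nearAt {k : ℕ} (hk : k < Ns T) : T.G.other (nearAt T k) = some (farAt T k) := by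
  obtain ⟨c', hc'⟩ := (nearAt_spec hT hk).1.1.exists_other
  rw [farAt, hc']
  rfl

/-- kernel: … and its far leg to its near leg. [cite: Balaban1983Higgs3, (1.21) p.416] -/
theorem other_farAt {k : ℕ} (hk : k < Ns T) : T.G.other (farAt T k) = some (nearAt T k) :=
  T.G.other_symm _ _ (other_nearAt hT hk)

/-- kernel: the far leg of the `k`-th separating line has level `k + 1`. [cite: Balaban1983Higgs3, (1.21) p.416] -/
theorem lvl_farAt {k : ℕ} (hk : k < Ns T) : Lv T (farAt T k).1 = k + 1 := by
  have h : Lv T (farAt T k).1 = Lv T (nearAt T k).1 + 1 := (nearAt_spec hT hk).1.level_far hT (other_nearAt hT hk)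
  rw [(nearAt_spec hT hk).2] at h
  exact h

/-- kernel: the far leg of the `k`-th separating line lies on a separating line. [cite: Balaban1983Higgs3, (1.21) p.416] -/
theorem sep_farAt {k : ℕ} (hk : k < Ns T) : Sep T.G T.legIn.1 T.legOut.1 (farAt T k) :=
  (nearAt_spec hT hk).1.1.of_other (other_nearAt hT hk)

/-- kernel: the two legs of a separating line have the same species. [cite: Balaban1983Higgs3, p.414] -/
theorem isLeft_farAt {k : ℕ} (hk : k < Ns T) : (farAt T k).2.isLeft = (nearAt T k).2.isLeft :=
  (T.G.other_isLeft _ _ (other_nearAt hT hk)).symm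

/-- **the in-port of the `k`-th piece lies at level `k`** (`k ≤ m`). [cite: Balaban1983Higgs3, (1.21) p.416] -/
theorem lvl_portIn {k : ℕ} (hk : k ≤ Ns T) : Lv T (portIn T k).1 = k := by
  unfold portIn
  split_ifs with h
  · subst h; exact level_left
  · rw [lvl_farAt hT (by omega)]; omega

/-- **the out-port of the `k`-th piece lies at level `k`** (`k ≤ m`). [cite: Balaban1983Higgs3, (1.21) p.416] -/
theorem lvl_portOut {k : ℕ} (hk : k ≤ Ns T) : Lv T (portOut T k).1 = k := by
  unfold portOut
  split_ifs with h
  · subst h; exact level_right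
  · exact (nearAt_spec hT (lt_of_le_of_ne hk h)).2

omit hT in
/-- kernel: the in-port of piece `0` is the in-leg. [cite: Balaban1983Higgs3, (1.21) p.416] -/
@[simp] theorem portIn_zero : portIn T 0 = T.legIn := by
  simp [portIn]

omit hT in
/-- kernel: the in-port of piece `k + 1` is the far leg of the `k`-th separating line. [cite: Balaban1983Higgs3, (1.21) p.416] -/
@[simp] theorem portIn_succ (k : ℕ) : portIn T (k + 1) = farAt T k := by
  simp [portIn]

omit hT in
/-- kernel: the out-port of the last piece is the out-leg. [cite: Balaban1983Higgs3, (1.21) p.416] -/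
theorem portOut_nsep : portOut T (Ns T) = T.legOut := by
  simp [portOut]

omit hT in
/-- kernel: the out-port of an earlier piece is the near leg of the next separating line.
[cite: Balaban1983Higgs3, (1.21) p.416] -/
theorem portOut_of_lt {k : ℕ} (hk : k < Ns T) : portOut T k = nearAt T k := by
  simp [portOut, hk.ne]

omit hT in
/-- **the in-port of piece `0` is external in `T`**. [cite: Balaban1983Higgs3, (1.21) p.416] -/
theorem other_portIn_zero : T.G.other (portIn T 0) = none := by
  rw [portIn_zero]; exact T.in_ext

/-- **the in-port of piece `k + 1` is joined in `T` to the out-port of piece `k`** (the `k`-th separating line).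
[cite: Balaban1983Higgs3, (1.21) p.416] -/
theorem other_portIn_succ {k : ℕ} (hk : k < Ns T) : T.G.other (portIn T (k + 1)) = some (portOut T k) := by
  rw [portIn_succ, portOut_of_lt hk]; exact other_farAt hT hk

omit hT in
/-- **the out-port of the last piece is external in `T`**. [cite: Balaban1983Higgs3, (1.21) p.416] -/
theorem other_portOut_nsep : T.G.other (portOut T (Ns T)) = none := by
  rw [portOut_nsep]; exact T.out_ext

/-- **the out-port of piece `k < m` is joined in `T` to the in-port of piece `k + 1`**. [cite: Balaban1983Higgs3, (1.21) p.416] -/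
theorem other_portOut_of_lt {k : ℕ} (hk : k < Ns T) : T.G.other (portOut T k) = some (portIn T (k + 1)) := by
  rw [portIn_succ, portOut_of_lt hk]; exact other_nearAt hT hk

/-- kernel: the line through an in-port (if any) comes from level `k - 1`, never from inside the piece.
[cite: Balaban1983Higgs3, (1.21) p.416] -/
theorem lvl_of_other_portIn {k : ℕ} (hk : k ≤ Ns T) {y : Leg T.G.kind} (hy : T.G.other (portIn T k) = some y) :
    Lv T y.1 + 1 = k := by
  cases k with
  | zero => rw [other_portIn_zero] at hy; cases hy
  | succ k =>
      rw [other_portIn_succ hT (by omega)] at hy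
      cases hy
      rw [lvl_portOut hT (by omega)]

/-- kernel: the line through an out-port (if any) goes to level `k + 1`, never into the piece.
[cite: Balaban1983Higgs3, (1.21) p.416] -/
theorem lvl_of_other_portOut {k : ℕ} (hk : k ≤ Ns T) {y : Leg T.G.kind} (hy : T.G.other (portOut T k) = some y) :
    Lv T y.1 = k + 1 := by
  rcases Nat.lt_or_eq_of_le hk with hk | rfl
  · rw [other_portOut_of_lt hT hk] at hy
    cases hy
    exact lvl_portIn hT (by omega)
  · rw [other_portOut_nsep] at hy; cases hy

/-- **the two ports of a piece are distinct legs**. [cite: Balaban1983Higgs3, (1.21) p.416] -/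
theorem portIn_ne_portOut {k : ℕ} (hk : k ≤ Ns T) : portIn T k ≠ portOut T k := by
  intro h
  rcases Nat.lt_or_eq_of_le hk with hk' | hkm
  · have h1 := other_portOut_of_lt hT hk'
    rw [← h] at h1
    have := lvl_of_other_portIn hT hk h1
    rw [lvl_portIn hT (by omega)] at this
    omega
  · cases k with
    | zero =>
        rw [portIn_zero, hkm, portOut_nsep] at h
        exact T.in_ne_out h
    | succ k =>
        have h1 := other_portIn_succ hT (k := k) (by omega)
        rw [h, hkm, other_portOut_nsep] at h1
        cases h1

end Ports

/-! ## §2 The two hypotheses, and the pieces as graphs of the model -/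

section Pieces

variable (T : TwoLegGraph nbar)

/-- HYPOTHESIS (a) «the separating lines are φ′-lines»: every leg on a line separating the in-leg of `T` from its out-leg is
a scalar leg (in (1.21) the lines between consecutive insertions are propagators `C₀^ε` of the SCALAR field; p37's `glue2`
glues φ′-ports).  Not automatic on p18's carrier (a vector line can separate two scalar external legs, e.g. through vertices
(1.14) with one φ′-leg each). [cite: Balaban1983Higgs3, (1.21) p.416] -/
def SepScalar (T : TwoLegGraph nbar) : Prop :=
  ∀ c : Leg T.G.kind, Sep T.G T.legIn.1 T.legOut.1 c → c.2.isLeft = true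

/-- HYPOTHESIS (b) at level `k` «the `k`-th piece spans an internal line»: some internal line of `T` has both endpoints at
level `k` (p. 415: a graph has *"at least one internal line"* — a line-less piece, e.g. a bare mass-renormalization vertex
(1.7) met along the channel, is print's separate letter `−δm²` of (1.21) and not a graph of the model).
[cite: Balaban1983Higgs3, p.415] -/
def SpansLine (T : TwoLegGraph nbar) (k : ℕ) : Prop :=
  ∃ x y : Leg T.G.kind, T.G.other x = some y ∧ Lv T x.1 = k ∧ Lv T y.1 = k

/-- `Unglueable T`: `T` is connected, its separating lines are φ′-lines, and each of its `m + 1` pieces spans a line — the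
exact conditions under which `T` unglues into a `chain` of two-leg insertions of the model (§4; and the image of `chain` over
connected port-proper letters satisfies them, §5). [cite: Balaban1983Higgs3, (1.21) p.416] -/
structure Unglueable (T : TwoLegGraph nbar) : Prop where
  /-- `T` is connected (p. 415) -/
  conn : IsConnected T.G
  /-- (a) the separating lines between the ports are φ′-lines -/
  sepScalar : SepScalar T
  /-- (b) every piece `V_0, …, V_m` spans an internal line -/
  spans : ∀ k ≤ Ns T, SpansLine T k

/-- The vertex set `V_k = {level = k}` of the `k`-th piece. [cite: Balaban1983Higgs3, (1.21) p.416] -/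
noncomputable def pieceVerts (k : ℕ) : Finset (Fin T.G.nV) :=
  univ.filter fun v => Lv T v = k

/-- The number of vertices of the `k`-th piece. [cite: Balaban1983Higgs3, (1.21) p.416] -/
noncomputable def pieceCard (k : ℕ) : ℕ := (pieceVerts T k).card

/-- The increasing enumeration of the vertices of the `k`-th piece (its vertex `u` is the vertex `pieceEmb T k u` of `T`).
[cite: Balaban1983Higgs3, (1.21) p.416] -/
noncomputable def pieceEmb (k : ℕ) : Fin (pieceCard T k) ↪o Fin T.G.nV :=
  (pieceVerts T k).orderEmbOfFin rfl

variable {T}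

/-- kernel: membership in `pieceVerts`. [cite: Balaban1983Higgs3, (1.21) p.416] -/
@[simp] theorem mem_pieceVerts {k : ℕ} {v : Fin T.G.nV} : v ∈ pieceVerts T k ↔ Lv T v = k := by
  simp [pieceVerts]

/-- kernel: the enumerated vertices have level `k`. [cite: Balaban1983Higgs3, (1.21) p.416] -/
@[simp] theorem lvl_pieceEmb (k : ℕ) (u : Fin (pieceCard T k)) : Lv T (pieceEmb T k u) = k :=
  mem_pieceVerts.1 (Finset.orderEmbOfFin_mem _ _ u)

/-- kernel: the enumeration is injective. [cite: Balaban1983Higgs3, (1.21) p.416] -/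
theorem pieceEmb_injective (k : ℕ) : Function.Injective (pieceEmb T k) :=
  (pieceEmb T k).injective

/-- kernel: every vertex of level `k` is enumerated. [cite: Balaban1983Higgs3, (1.21) p.416] -/
theorem exists_pieceEmb_eq {k : ℕ} {v : Fin T.G.nV} (hv : Lv T v = k) : ∃ u, pieceEmb T k u = v := by
  have h : v ∈ Set.range (pieceEmb T k) := by
    rw [pieceEmb, Finset.range_orderEmbOfFin, Finset.mem_coe]
    exact mem_pieceVerts.2 hv
  exact h

/-- The index of a vertex of level `k` in the enumeration of the `k`-th piece. [cite: Balaban1983Higgs3, (1.21) p.416] -/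
noncomputable def pieceIdx {k : ℕ} (v : Fin T.G.nV) (hv : Lv T v = k) : Fin (pieceCard T k) :=
  (exists_pieceEmb_eq hv).choose

/-- kernel: `pieceEmb ∘ pieceIdx = id`. [cite: Balaban1983Higgs3, (1.21) p.416] -/
@[simp] theorem pieceEmb_pieceIdx {k : ℕ} (v : Fin T.G.nV) (hv : Lv T v = k) : pieceEmb T k (pieceIdx v hv) = v :=
  (exists_pieceEmb_eq hv).choose_spec

/-- kernel: `pieceIdx ∘ pieceEmb = id`. [cite: Balaban1983Higgs3, (1.21) p.416] -/
@[simp] theorem pieceIdx_pieceEmb {k : ℕ} (u : Fin (pieceCard T k)) (h : Lv T (pieceEmb T k u) = k) :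
    pieceIdx (pieceEmb T k u) h = u :=
  pieceEmb_injective k (pieceEmb_pieceIdx _ _)

/-- kernel: the index depends only on the vertex. [cite: Balaban1983Higgs3, (1.21) p.416] -/
theorem pieceIdx_congr {k : ℕ} {v w : Fin T.G.nV} (e : v = w) {hv : Lv T v = k}
    {hw : Lv T w = k} : pieceIdx v hv = pieceIdx w hw := by
  subst e
  rfl

variable (T)

/-- The catalogue kinds of the vertices of the `k`-th piece (those of `T`). [cite: Balaban1983Higgs3, (1.21) p.416] -/
noncomputable def pieceKind (k : ℕ) : Fin (pieceCard T k) → VertexKind := fun u => T.G.kind (pieceEmb T k u)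

/-- The leg of `T` underlying a leg of the `k`-th piece (same slot at the enumerated vertex).
[cite: Balaban1983Higgs3, (1.17) p.415] -/
noncomputable def pieceLeg (k : ℕ) (x : Leg (pieceKind T k)) : Leg T.G.kind := ⟨pieceEmb T k x.1, x.2⟩

/-- The leg of the `k`-th piece over a leg of `T` whose vertex has level `k`. [cite: Balaban1983Higgs3, (1.17) p.415] -/
noncomputable def liftLeg (k : ℕ) (y : Leg T.G.kind) (hy : Lv T y.1 = k) : Leg (pieceKind T k) :=
  ⟨pieceIdx y.1 hy, fibreCast (congrArg T.G.kind (pieceEmb_pieceIdx y.1 hy)).symm y.2⟩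

/-- The leg of the `k`-th piece over a leg of `T`, if its vertex has level `k` (else `none`).
[cite: Balaban1983Higgs3, (1.17) p.415] -/
noncomputable def pieceLegInv (k : ℕ) (y : Leg T.G.kind) : Option (Leg (pieceKind T k)) :=
  open Classical in
  if h : Lv T y.1 = k then some (liftLeg T k y h) else none

/-- THE LINES OF THE `k`-TH PIECE: the line of `T` through the underlying leg, if its other endpoint has level `k` too —
i.e. (`B3OnePIChainDecomposition.level_eq_of_not_sep` / `line_cases`) iff it is not a separating line; the two separating
lines at the ports of the piece are cut, their legs become the external ports. [cite: Balaban1983Higgs3, (1.21) p.416] -/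
noncomputable def pieceOther (k : ℕ) (x : Leg (pieceKind T k)) : Option (Leg (pieceKind T k)) :=
  (T.G.other (pieceLeg T k x)).bind (pieceLegInv T k)

variable {T}

/-- kernel: the vertex of the underlying leg. [cite: Balaban1983Higgs3, (1.17) p.415] -/
@[simp] theorem fst_pieceLeg (k : ℕ) (x : Leg (pieceKind T k)) : (pieceLeg T k x).1 = pieceEmb T k x.1 := rfl

/-- kernel: the species of the underlying leg. [cite: Balaban1983Higgs3, (1.17) p.415] -/
@[simp] theorem isLeft_pieceLeg (k : ℕ) (x : Leg (pieceKind T k)) : (pieceLeg T k x).2.isLeft = x.2.isLeft := rfl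

/-- kernel: the underlying leg sits at a vertex of level `k`. [cite: Balaban1983Higgs3, (1.21) p.416] -/
theorem lvl_pieceLeg (k : ℕ) (x : Leg (pieceKind T k)) : Lv T (pieceLeg T k x).1 = k :=
  lvl_pieceEmb k x.1

/-- kernel: `pieceLeg` is the leg map `legOf` of the enumeration. [cite: Balaban1983Higgs3, (1.17) p.415] -/
theorem pieceLeg_eq_legOf (k : ℕ) (x : Leg (pieceKind T k)) : pieceLeg T k x = legOf (pieceEmb T k) (fun _ => rfl) x :=
  leg_ext rfl (by simp [pieceLeg, legOf])

/-- kernel: `pieceLeg` is injective. [cite: Balaban1983Higgs3, (1.17) p.415] -/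
theorem pieceLeg_injective (k : ℕ) : Function.Injective (pieceLeg T k) := by
  intro x y h
  rw [pieceLeg_eq_legOf, pieceLeg_eq_legOf] at h
  exact legOf_injective (pieceEmb_injective k) _ h

/-- kernel (plumbing): re-basing a leg along an equality of vertices. [cite: Balaban1983Higgs3, (1.17) p.415] -/
theorem leg_mk_fibreCast {n : ℕ} {kind : Fin n → VertexKind} {v w : Fin n} (e : w = v)
    (s : Fin (kind v).scalarLegs ⊕ Fin (kind v).vectorLegs) :
    (⟨w, fibreCast (congrArg kind e).symm s⟩ : Leg kind) = ⟨v, s⟩ := by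
  subst e
  simp

/-- kernel: `pieceLeg ∘ liftLeg = id`. [cite: Balaban1983Higgs3, (1.17) p.415] -/
@[simp] theorem pieceLeg_liftLeg (k : ℕ) (y : Leg T.G.kind) (hy : Lv T y.1 = k) :
    pieceLeg T k (liftLeg T k y hy) = y := by
  obtain ⟨v, s⟩ := y
  exact leg_mk_fibreCast (kind := T.G.kind) (pieceEmb_pieceIdx v hy) s

/-- kernel: `liftLeg ∘ pieceLeg = id`. [cite: Balaban1983Higgs3, (1.17) p.415] -/
@[simp] theorem liftLeg_pieceLeg (k : ℕ) (x : Leg (pieceKind T k)) (h : Lv T (pieceLeg T k x).1 = k) :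
    liftLeg T k (pieceLeg T k x) h = x :=
  pieceLeg_injective k (pieceLeg_liftLeg k _ h)

/-- kernel: `liftLeg` is injective on the legs of level `k`. [cite: Balaban1983Higgs3, (1.17) p.415] -/
theorem liftLeg_inj {k : ℕ} {y y' : Leg T.G.kind} {hy : Lv T y.1 = k} {hy' : Lv T y'.1 = k}
    (h : liftLeg T k y hy = liftLeg T k y' hy') : y = y' := by
  rw [← pieceLeg_liftLeg k y hy, ← pieceLeg_liftLeg k y' hy', h]

/-- kernel: `pieceLegInv` on a leg of level `k`. [cite: Balaban1983Higgs3, (1.17) p.415] -/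
theorem pieceLegInv_of_eq {k : ℕ} (y : Leg T.G.kind) (hy : Lv T y.1 = k) : pieceLegInv T k y = some (liftLeg T k y hy) := by
  classical
  rw [pieceLegInv, dif_pos hy]

/-- kernel: `pieceLegInv` off level `k`. [cite: Balaban1983Higgs3, (1.17) p.415] -/
theorem pieceLegInv_of_ne {k : ℕ} (y : Leg T.G.kind) (hy : Lv T y.1 ≠ k) : pieceLegInv T k y = none := by
  classical
  rw [pieceLegInv, dif_neg hy]

/-- kernel: `pieceLegInv T k y = some x` iff `y` is the leg underlying `x`. [cite: Balaban1983Higgs3, (1.17) p.415] -/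
theorem pieceLegInv_eq_some_iff {k : ℕ} {y : Leg T.G.kind} {x : Leg (pieceKind T k)} :
    pieceLegInv T k y = some x ↔ pieceLeg T k x = y := by
  constructor
  · intro h
    by_cases hy : Lv T y.1 = k
    · rw [pieceLegInv_of_eq y hy, Option.some.injEq] at h
      rw [← h, pieceLeg_liftLeg]
    · rw [pieceLegInv_of_ne y hy] at h
      cases h
  · rintro rfl
    rw [pieceLegInv_of_eq _ (lvl_pieceLeg k x), liftLeg_pieceLeg]

/-- **the lines of the piece are lines of `T`**: `pieceOther x = some y` iff the line of `T` through the leg under `x`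
ends at the leg under `y`. [cite: Balaban1983Higgs3, (1.21) p.416] -/
theorem pieceOther_eq_some_iff {k : ℕ} {x y : Leg (pieceKind T k)} :
    pieceOther T k x = some y ↔ T.G.other (pieceLeg T k x) = some (pieceLeg T k y) := by
  rw [pieceOther, Option.bind_eq_some_iff]
  constructor
  · rintro ⟨z, hz, hzy⟩
    rw [hz, ← pieceLegInv_eq_some_iff.1 hzy]
  · intro h
    exact ⟨_, h, pieceLegInv_eq_some_iff.2 rfl⟩

/-- kernel: a leg of the piece is external iff the leg of `T` under it is external or its line leaves the level `k`.
[cite: Balaban1983Higgs3, (1.21) p.416] -/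
theorem pieceOther_eq_none_iff {k : ℕ} {x : Leg (pieceKind T k)} :
    pieceOther T k x = none ↔ ∀ z, T.G.other (pieceLeg T k x) = some z → Lv T z.1 ≠ k := by
  rw [pieceOther, Option.bind_eq_none_iff]
  constructor
  · intro h z hz hzk
    exact absurd (h z hz ▸ pieceLegInv_of_eq z hzk) (by simp)
  · intro h z hz
    exact pieceLegInv_of_ne z (h z hz)

/-- kernel: a line of `T` between two legs of level `k` is a line of the piece (through the lifted legs).
[cite: Balaban1983Higgs3, (1.21) p.416] -/
theorem pieceOther_liftLeg {k : ℕ} {y z : Leg T.G.kind} (hyz : T.G.other y = some z) (hy : Lv T y.1 = k) (hz : Lv T z.1 = k) :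
    pieceOther T k (liftLeg T k y hy) = some (liftLeg T k z hz) :=
  pieceOther_eq_some_iff.2 (by simpa using hyz)

variable (T)

/-- **THE `k`-TH PIECE AS A GRAPH OF THE MODEL** (p. 415): the vertices of `T` of level `k` with their catalogue kinds and
side conditions, the lines of `T` joining two of them; *"at least one internal line"* is hypothesis (b) `SpansLine T k`.
[cite: Balaban1983Higgs3, p.415] -/
noncomputable def pieceGraph (k : ℕ) (h : SpansLine T k) : Graph nbar where
  nV := pieceCard T k
  kind := pieceKind T k
  adm u := T.G.adm _
  other := pieceOther T k
  other_ne x y hxy := by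
    rw [pieceOther_eq_some_iff] at hxy
    intro e
    exact T.G.other_ne _ _ hxy (by rw [e])
  other_symm x y hxy := by
    rw [pieceOther_eq_some_iff] at hxy ⊢
    exact T.G.other_symm _ _ hxy
  other_isLeft x y hxy := by
    rw [pieceOther_eq_some_iff] at hxy
    exact T.G.other_isLeft _ _ hxy
  exists_line := by
    obtain ⟨y, z, hyz, hy, hz⟩ := h
    exact ⟨liftLeg T k y hy, by rw [pieceOther_liftLeg hyz hy hz]; rfl⟩

variable {T}

/-- kernel: adjacency in the piece is adjacency in `T` between the enumerated vertices. [cite: Balaban1983Higgs3, (1.21) p.416] -/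
theorem adj_pieceGraph_iff {k : ℕ} (h : SpansLine T k) {u u' : Fin (pieceCard T k)} :
    Adj (pieceGraph T k h) u u' ↔ Adj T.G (pieceEmb T k u) (pieceEmb T k u') := by
  constructor
  · intro hadj
    obtain ⟨x, y, hxy, rfl, rfl⟩ := adj_iff.1 hadj
    exact adj_iff.2 ⟨pieceLeg T k x, pieceLeg T k y, pieceOther_eq_some_iff.1 hxy, rfl, rfl⟩
  · intro hadj
    obtain ⟨y, z, hyz, hy, hz⟩ := adj_iff.1 hadj
    have hyk : Lv T y.1 = k := by rw [hy]; exact lvl_pieceEmb k u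
    have hzk : Lv T z.1 = k := by rw [hz]; exact lvl_pieceEmb k u'
    refine adj_iff.2 ⟨liftLeg T k y hyk, liftLeg T k z hzk, pieceOther_liftLeg hyz hyk hzk, ?_, ?_⟩
    · exact pieceEmb_injective k (by simp [liftLeg, hy])
    · exact pieceEmb_injective k (by simp [liftLeg, hz])

/-- kernel: a path of `T` all of whose vertices have level `k` lifts to a path of the `k`-th piece.
[cite: Balaban1983Higgs3, (1.21) p.416] -/
theorem reflTransGen_pieceIdx {k : ℕ} {r : Fin T.G.nV → Fin T.G.nV → Prop} {P : Fin (pieceCard T k) → Fin (pieceCard T k) → Prop}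
    (hr : ∀ a b (ha : Lv T a = k) (hb : Lv T b = k),
      r a b → P (pieceIdx a ha) (pieceIdx b hb))
    (hlv : ∀ a b, r a b → Lv T a = k) {a b : Fin T.G.nV} (hab : ReflTransGen r a b)
    (ha : Lv T a = k) (hb : Lv T b = k) :
    ReflTransGen P (pieceIdx a ha) (pieceIdx b hb) := by
  induction hab with
  | refl => exact ReflTransGen.refl
  | @tail c d _ hcd ih => exact (ih (hlv c d hcd)).tail (hr c d (hlv c d hcd) hb hcd)

/-- **THE PIECES ARE CONNECTED** (gen 42's `pieces_connected`, now inside the piece graph).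
[cite: Balaban1983Higgs3, (1.21) p.416] -/
theorem isConnected_pieceGraph (hT : IsConnected T.G) {k : ℕ} (h : SpansLine T k) : IsConnected (pieceGraph T k h) := by
  intro u u'
  have hp := pieces_connected (i := T.legIn.1) (j := T.legOut.1) hT
    (u := pieceEmb T k u) (v := pieceEmb T k u') (by rw [lvl_pieceEmb, lvl_pieceEmb])
  rw [lvl_pieceEmb] at hp
  have key : ReflTransGen (Adj (pieceGraph T k h)) (pieceIdx (pieceEmb T k u) (lvl_pieceEmb k u))
      (pieceIdx (pieceEmb T k u') (lvl_pieceEmb k u')) :=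
    reflTransGen_pieceIdx (P := Adj (pieceGraph T k h))
      (r := fun a b => Adj T.G a b ∧ Lv T a = k ∧ Lv T b = k)
      (fun a b ha hb hab => (adj_pieceGraph_iff h).2 (by simpa using hab.1))
      (fun a b hab => hab.2.1) hp (lvl_pieceEmb k u) (lvl_pieceEmb k u')
  rwa [pieceIdx_pieceEmb, pieceIdx_pieceEmb] at key

/-- kernel: after cutting the line of `T` through a leg `c` of level `k`, an adjacency of `T` between vertices of level `k`
avoiding that line is an adjacency of the piece avoiding the lifted leg. [cite: Balaban1983Higgs3, (1.21) p.416] -/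
theorem adjOff_pieceGraph_of {k : ℕ} (h : SpansLine T k) {c : Leg T.G.kind} (hc : Lv T c.1 = k) {a b : Fin T.G.nV}
    (ha : Lv T a = k) (hb : Lv T b = k) (hab : AdjOff T.G c a b) :
    AdjOff (pieceGraph T k h) (liftLeg T k c hc) (pieceIdx a ha) (pieceIdx b hb) := by
  obtain ⟨y, z, hyz, hyc, hzc, rfl, rfl⟩ := adjOffOf_iff.1 hab
  refine adjOffOf_iff.2 ⟨liftLeg T k y ha, liftLeg T k z hb, pieceOther_liftLeg hyz ha hb,
    fun e => hyc (liftLeg_inj e), fun e => hzc (liftLeg_inj e), rfl, rfl⟩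

/-- **THE PIECES ARE PROPER BETWEEN THEIR PORTS**: no internal line of the `k`-th piece separates the vertex of its in-port
from the vertex of its out-port (gen 42's `proper_zero` / `proper_succ` / `proper_last` / `proper_none`, now inside the piece
graph): `numSep = 0` between the ports. [cite: Balaban1983Higgs3, (1.21) p.416] -/
theorem numSep_pieceGraph_ports (hT : IsConnected T.G) {k : ℕ} (hk : k ≤ Ns T) (h : SpansLine T k) :
    numSep (pieceGraph T k h) (pieceIdx (portIn T k).1 (lvl_portIn hT hk))
      (pieceIdx (portOut T k).1 (lvl_portOut hT hk)) = 0 := by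
  refine (numSep_eq_zero_iff (isConnected_pieceGraph hT h)).2 fun c hcs => ?_
  -- the cut leg `c` of the piece lies over a leg `x` of `T` on a non-separating line
  obtain ⟨c', hc'⟩ := Option.isSome_iff_exists.1 hcs
  have hxc' : T.G.other (pieceLeg T k c) = some (pieceLeg T k c') := pieceOther_eq_some_iff.1 hc'
  have hx : ¬ Sep T.G T.legIn.1 T.legOut.1 (pieceLeg T k c) :=
    not_sep_of_level_eq hT hxc' ((lvl_pieceLeg k c).trans (lvl_pieceLeg k c').symm)
  have hcl : liftLeg T k (pieceLeg T k c) (lvl_pieceLeg k c) = c := liftLeg_pieceLeg k c _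
  -- the port walk of gen 42 inside `V_k`, avoiding the line of `x`, transported into the piece
  have lift : ∀ {a b : Fin T.G.nV} (ha : Lv T a = k) (hb : Lv T b = k),
      ReflTransGen (fun a b => AdjOff T.G (pieceLeg T k c) a b ∧ Lv T a = k ∧ Lv T b = k) a b →
      ReflTransGen (AdjOff (pieceGraph T k h) c) (pieceIdx a ha) (pieceIdx b hb) := by
    intro a b ha hb hab
    exact reflTransGen_pieceIdx (P := AdjOff (pieceGraph T k h) c)
      (r := fun a b => AdjOff T.G (pieceLeg T k c) a b ∧ Lv T a = k ∧
        Lv T b = k)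
      (fun a b ha hb hab => by
        have := adjOff_pieceGraph_of h (lvl_pieceLeg k c) ha hb hab.1
        rwa [hcl] at this)
      (fun a b hab => hab.2.1) hab ha hb
  rcases Nat.eq_zero_or_pos (Ns T) with hm | hm
  · -- one piece: `k = 0 = m`
    have hk0 : k = 0 := by omega
    subst hk0
    have hw := proper_none hT hx hm
    have e₁ : (portIn T 0).1 = T.legIn.1 := by rw [portIn_zero]
    have e₂ : (portOut T 0).1 = T.legOut.1 := by rw [← hm, portOut_nsep]
    have := lift (a := T.legIn.1) (b := T.legOut.1) level_left (by rw [← hm]; exact level_right) hw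
    rwa [pieceIdx_congr e₁, pieceIdx_congr e₂]
  rcases Nat.eq_zero_or_pos k with hk0 | hk0
  · -- first piece, `m > 0`
    subst hk0
    obtain ⟨hd, hd0⟩ := nearAt_spec hT hm
    have hw := proper_zero hT hx hd hd0
    have e₁ : (portIn T 0).1 = T.legIn.1 := by rw [portIn_zero]
    have e₂ : (portOut T 0).1 = (nearAt T 0).1 := by rw [portOut_of_lt hm]
    have := lift (a := T.legIn.1) (b := (nearAt T 0).1) level_left hd0 hw
    rwa [pieceIdx_congr e₁, pieceIdx_congr e₂]
  rcases Nat.lt_or_eq_of_le hk with hkm | hkm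
  · -- inner piece `0 < k < m`
    obtain ⟨hc, hck⟩ := nearAt_spec hT (show k - 1 < Ns T by omega)
    obtain ⟨hd, hdk⟩ := nearAt_spec hT hkm
    have hsucc : Lv T (nearAt T k).1 = Lv T (nearAt T (k - 1)).1 + 1 := by rw [hck, hdk]; omega
    have hw := proper_succ hT hx hc (other_nearAt hT (by omega)) hd hsucc
    have e₁ : (portIn T k).1 = (farAt T (k - 1)).1 := by
      obtain ⟨k', rfl⟩ : ∃ k', k = k' + 1 := ⟨k - 1, by omega⟩
      rw [portIn_succ]; rfl
    have e₂ : (portOut T k).1 = (nearAt T k).1 := by rw [portOut_of_lt hkm]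
    have hwk : ReflTransGen (fun a b => AdjOff T.G (pieceLeg T k c) a b ∧ Lv T a = k ∧ Lv T b = k)
        (farAt T (k - 1)).1 (nearAt T k).1 := by
      refine reflTransGen_of_imp (fun a b hab => ⟨hab.1, ?_, ?_⟩) hw
      · have := hab.2.1; rw [hdk] at this; exact this
      · have := hab.2.2; rw [hdk] at this; exact this
    have := lift (a := (farAt T (k - 1)).1) (b := (nearAt T k).1) (by rw [lvl_farAt hT (by omega)]; omega) hdk hwk
    rwa [pieceIdx_congr e₁, pieceIdx_congr e₂]
  · -- last piece `k = m > 0`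
    subst hkm
    obtain ⟨hc, hck⟩ := nearAt_spec hT (show Ns T - 1 < Ns T by omega)
    have hm' : Lv T (nearAt T (Ns T - 1)).1 + 1 = Ns T := by rw [hck]; omega
    have hw := proper_last hT hx hc (other_nearAt hT (by omega)) hm'
    have e₁ : (portIn T (Ns T)).1 = (farAt T (Ns T - 1)).1 := by
      obtain ⟨k', hk'⟩ : ∃ k', Ns T = k' + 1 := ⟨Ns T - 1, by omega⟩
      rw [hk', portIn_succ]; simp
    have e₂ : (portOut T (Ns T)).1 = T.legOut.1 := by rw [portOut_nsep]
    have hwk : ReflTransGen (fun a b => AdjOff T.G (pieceLeg T (Ns T) c) a b ∧ Lv T a = Ns T ∧ Lv T b = Ns T)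
        (farAt T (Ns T - 1)).1 T.legOut.1 := reflTransGen_of_imp (fun a b hab => hab) hw
    have := lift (a := (farAt T (Ns T - 1)).1) (b := T.legOut.1)
      (by rw [lvl_farAt hT (by omega)]; omega) level_right hwk
    rwa [pieceIdx_congr e₁, pieceIdx_congr e₂]

/-- kernel: the species of a lifted leg. [cite: Balaban1983Higgs3, (1.17) p.415] -/
@[simp] theorem isLeft_liftLeg (k : ℕ) (y : Leg T.G.kind) (hy : Lv T y.1 = k) :
    (liftLeg T k y hy).2.isLeft = y.2.isLeft := by
  simp only [liftLeg, isLeft_fibreCast]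

/-- kernel: the lift depends only on the leg. [cite: Balaban1983Higgs3, (1.17) p.415] -/
theorem liftLeg_congr {k : ℕ} {x y : Leg T.G.kind} (e : x = y) {hx : Lv T x.1 = k}
    {hy : Lv T y.1 = k} : liftLeg T k x hx = liftLeg T k y hy := by
  subst e
  rfl

variable (T)

/-- **THE `k`-TH PIECE AS A TWO-LEG INSERTION** (`k ≤ m`): the piece graph with in-port = the in-leg of `T` (`k = 0`) / the
far leg of the `k`-th separating line, out-port = the near leg of the `(k+1)`-th separating line / the out-leg of `T` (`k = m`)
— the `k`-th LETTER of the chain `C₀^ε K₀ C₀^ε K₁ ⋯ K_m C₀^ε` that `T` is (§3–§4). [cite: Balaban1983Higgs3, (1.21) p.416] -/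
noncomputable def piece (hU : Unglueable T) (k : ℕ) (hk : k ≤ Ns T) : TwoLegGraph nbar where
  G := pieceGraph T k (hU.spans k hk)
  legIn := liftLeg T k (portIn T k) (lvl_portIn hU.conn hk)
  legOut := liftLeg T k (portOut T k) (lvl_portOut hU.conn hk)
  in_ext := pieceOther_eq_none_iff.2 fun z hz => by
    rw [pieceLeg_liftLeg] at hz
    have := lvl_of_other_portIn hU.conn hk hz
    omega
  out_ext := pieceOther_eq_none_iff.2 fun z hz => by
    rw [pieceLeg_liftLeg] at hz
    have := lvl_of_other_portOut hU.conn hk hz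
    omega
  in_ne_out h := portIn_ne_portOut hU.conn hk (liftLeg_inj h)
  in_scalar := (isLeft_liftLeg k (portIn T k) (lvl_portIn hU.conn hk)).trans (by
    cases k with
    | zero => rw [portIn_zero]; exact T.in_scalar
    | succ k => rw [portIn_succ]; exact hU.sepScalar _ (sep_farAt hU.conn (by omega)))
  out_scalar := (isLeft_liftLeg k (portOut T k) (lvl_portOut hU.conn hk)).trans (by
    rcases Nat.lt_or_eq_of_le hk with hk' | rfl
    · rw [portOut_of_lt hk']; exact hU.sepScalar _ (nearAt_spec hU.conn hk').1.1
    · rw [portOut_nsep]; exact T.out_scalar)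

variable {T}

/-- **each piece is a CONNECTED insertion**. [cite: Balaban1983Higgs3, p.415] -/
theorem isConnected_piece (hU : Unglueable T) (k : ℕ) (hk : k ≤ Ns T) :
    IsConnected (piece T hU k hk).G :=
  isConnected_pieceGraph hU.conn (hU.spans k hk)

/-- **each piece is PROPER BETWEEN ITS PORTS**: no internal line of the piece separates its in-port from its out-port
(`numSep = 0`; for an insertion with exactly its two ports external this is p37's `IsProper`, by
`B3OnePIChainPieces.isProper_iff_numSep_eq_zero`). [cite: Balaban1983Higgs3, (1.21) p.416] -/
theorem numSep_piece (hU : Unglueable T) (k : ℕ) (hk : k ≤ Ns T) :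
    numSep (piece T hU k hk).G (piece T hU k hk).legIn.1 (piece T hU k hk).legOut.1 = 0 :=
  numSep_pieceGraph_ports hU.conn hk (hU.spans k hk)

/-- kernel: the vertices of the `k`-th piece are as many as the vertices of `T` of level `k`.
[cite: Balaban1983Higgs3, (1.21) p.416] -/
theorem piece_nV (hU : Unglueable T) (k : ℕ) (hk : k ≤ Ns T) :
    (piece T hU k hk).G.nV = (univ.filter fun v => Lv T v = k).card := rfl

end Pieces


end Literature.MathematicalPhysics.QuantumFieldTheory.Balaban1983to89.B3OnePIChainPieceGraphs
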